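import Literature.Computability.QuantumComplexity.GapPClosure
import Literature.Computability.Complexity.FPStringBricks
import HarnessLib

/-!
# Amplification of `AWPP`: from constant error `1/3` to error `2^{-k(n)}` (Fenner; Fortnow–Rogers)

Second step of the proof of Li's theorem "`AWPP` is low for `PP`" (Fortnow–Rogers 1999, Thm. 3.3),
for the tree's `AWPP` (`CountingSimulation.lean`: Fenner's one-`GapP`-function, constant-error,
dyadic form — `g(x)/2^{p(|x|)} ∈ [2/3, 1]` on members, `∈ [0, 1/3]` on non-members). Lowness
needs the original small-error form of Fenner–Fortnow–Kurtz–Li / Fortnow–Rogers, Def. 2.5: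

> "`L ∈ AWPP` iff for every polynomial `q` there are `f ∈ GapP` and a polynomial-time computable
> `g > 0` with `Pr`-like thresholds `1 - 2^{-q(m)}` / `2^{-q(m)}` for `f(x, 1^m)/g(1^m)`, `m ≥ |x|`"

i.e. the error must be made exponentially small **in an auxiliary length parameter**, uniformly
over all shorter query strings, with a common denominator. Fenner (2003, Thm. 1.2, with
Fenner–Fortnow–Kurtz–Li 2003, §6 remark) shows that the constant-error form amplifies to this one.
This file proves that amplification for the tree's classes (`exists_amplifier`):

for `L ∈ AWPP` and polynomials `k`, `r` there are `G ∈ GapP` and a polynomial `e` such that for all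
`z`, `u` with `|z| ≤ r(|u|)`: `0 ≤ G⟨z, u⟩ ≤ 2^{e|u|}`, `z ∈ L → (2^{k|u|} - 1)·2^{e|u|} ≤ 2^{k|u|}·G⟨z, u⟩`,
`z ∉ L → 2^{k|u|}·G⟨z, u⟩ ≤ 2^{e|u|}`.

Construction (majority vote written as a `GapP` polynomial, Fortnow–Rogers §2 / Fenner 2003 §3):
with `a = g(z)`, `b = 2^{p|z|} - g(z)` (both `≥ 0`) and `N = 12(k|u| + 1)` trials,
`G⟨z, u⟩ = 2^{e|u| - p|z|N} · Σ_{c ∈ {0,1}^N, |c|₁ > N/2} a^{|c|₁} b^{|c|₀}`, a `GapP` function by the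
closure properties of `GapPClosure.lean` (`prod_mem_GapP` over the trials, the bit of the pattern
`c` selecting `a` or `b`; `sum_mem_GapP` over the patterns restricted to the `P` test "majority of
ones", `exists_majPat`; scaling by `2^{|t V|}` for the `FP` exponent `t`, `two_pow_length_mem_GapP`).
The estimate is elementary (no probability): `Σ_c a^{|c|₁} b^{|c|₀} = (a + b)^N` and, when
`2b ≤ a` (resp. `2a ≤ b`), every minority (resp. majority) term is at most `(ab)^{N/2}` while
`9ab ≤ 2(a+b)²`, so the bad terms sum to at most `2^N (2/9)^{N/2} (a+b)^N = (8/9)^{N/2}(a+b)^N ≤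
2^{-N/12}(a+b)^N` (`2^19 ≤ 9^6`; lemmas `nine_mul_le`, `key_pow_le`, `sum_minority_le`,
`sum_majority_le`, `sum_weight_eq`).

## References

* S. Fenner, *PP-lowness and a simple definition of AWPP*, Theory Comput. Syst. 36 (2003)
  199–212 (= ECCC TR02-036), Thm. 1.2 (the constant-error, single-`GapP`-function form of `AWPP`
  is equivalent to the original one), §3.
* S. Fenner, L. Fortnow, S. Kurtz, L. Li, *An oracle builder's toolkit*, Inform. and Comput. 182
  (2003) 95–136, Def. 6.1 (`AWPP`) and the remark following it (amplification, Li's lowness theorem).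
* L. Fortnow, J. Rogers, *Complexity limitations on quantum computation*, J. Comput. System Sci.
  59 (1999) 240–252 = arXiv:cs/9811023, Def. 2.5 (`AWPP` with thresholds `1 - 2^{-q}`, `2^{-q}` and
  the padding parameter `1^m`), Thm. 2.2 (closure properties of `GapP`).
-/

noncomputable section

open Computability Literature.Computability.Complexity Literature.Computability.Cryptography

namespace Literature.Computability.QuantumComplexity

open Polynomial Finset Literature.Computability.Complexity.TTClosure
  Literature.Computability.Complexity.PPSharpP Literature.Computability.Complexity.Brick
  Literature.Computability.Complexity.Plumb Literature.Computability.Complexity.HashBricks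
  Literature.Computability.Complexity.ParityClosure AWPPPP GapPRing GapPClosure

open scoped Classical

namespace AWPPAmp

/-! ### The elementary majority-vote estimate -/

/-- `9ab ≤ 2(a+b)²` as soon as one of `a`, `b` is at least twice the other
(`2(a+b)² - 9ab = (2a - b)(a - 2b)`). [folklore] -/
theorem nine_mul_le {a b : ℕ} (h : 2 * b ≤ a ∨ 2 * a ≤ b) : 9 * (a * b) ≤ 2 * (a + b) ^ 2 := by
  rcases h with h | h
  · obtain ⟨t, rfl⟩ := Nat.exists_eq_add_of_le h
    nlinarith [Nat.zero_le (t * b), Nat.zero_le (t * t)]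
  · obtain ⟨t, rfl⟩ := Nat.exists_eq_add_of_le h
    nlinarith [Nat.zero_le (t * a), Nat.zero_le (t * t)]

/-- **The numerical heart**: `9ab ≤ 2(a+b)²` gives `2^K · 2^{12K} · (ab)^{6K} ≤ (a+b)^{12K}`
(raise to the `6K`-th power and use `2^19 = 524288 ≤ 531441 = 9^6`). [folklore] -/
theorem key_pow_le {a b K : ℕ} (h : 9 * (a * b) ≤ 2 * (a + b) ^ 2) :
    2 ^ K * 2 ^ (12 * K) * (a * b) ^ (6 * K) ≤ (a + b) ^ (12 * K) := by
  have h6 : (9 * (a * b)) ^ (6 * K) ≤ (2 * (a + b) ^ 2) ^ (6 * K) := Nat.pow_le_pow_left h _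
  have hnumK : (2 ^ 19) ^ K ≤ (9 ^ 6) ^ K := Nat.pow_le_pow_left (by norm_num) K
  have hsq : ((a + b) ^ 2) ^ (6 * K) = (a + b) ^ (12 * K) := by
    rw [← pow_mul, show 2 * (6 * K) = 12 * K by ring]
  have h19 : 2 ^ K * 2 ^ (12 * K) * 2 ^ (6 * K) = (2 ^ 19) ^ K := by
    rw [← pow_add, ← pow_add, ← pow_mul, show K + 12 * K + 6 * K = 19 * K by ring]
  refine Nat.le_of_mul_le_mul_left ?_ (show 0 < 9 ^ (6 * K) from by positivity)
  calc 9 ^ (6 * K) * (2 ^ K * 2 ^ (12 * K) * (a * b) ^ (6 * K))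
      = 2 ^ K * 2 ^ (12 * K) * (9 ^ (6 * K) * (a * b) ^ (6 * K)) := by ring
    _ = 2 ^ K * 2 ^ (12 * K) * (9 * (a * b)) ^ (6 * K) := by rw [← mul_pow]
    _ ≤ 2 ^ K * 2 ^ (12 * K) * (2 * (a + b) ^ 2) ^ (6 * K) := Nat.mul_le_mul_left _ h6
    _ = 2 ^ K * 2 ^ (12 * K) * 2 ^ (6 * K) * (a + b) ^ (12 * K) := by rw [mul_pow, hsq]; ring
    _ = (2 ^ 19) ^ K * (a + b) ^ (12 * K) := by rw [h19]
    _ ≤ (9 ^ 6) ^ K * (a + b) ^ (12 * K) := Nat.mul_le_mul_right _ hnumK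
    _ = 9 ^ (6 * K) * (a + b) ^ (12 * K) := by rw [← pow_mul]

/-- A minority term is at most `(ab)^{6K}` when `b ≤ a`. [folklore] -/
theorem term_le_of_le {a b K c : ℕ} (hba : b ≤ a) (hc : c ≤ 6 * K) :
    a ^ c * b ^ (12 * K - c) ≤ (a * b) ^ (6 * K) := by
  have h1 : b ^ (6 * K - c) ≤ a ^ (6 * K - c) := Nat.pow_le_pow_left hba _
  calc a ^ c * b ^ (12 * K - c) = a ^ c * (b ^ (6 * K - c) * b ^ (6 * K)) := by
        rw [← pow_add]; congr 2; omega
    _ ≤ a ^ c * (a ^ (6 * K - c) * b ^ (6 * K)) := Nat.mul_le_mul_left _ (Nat.mul_le_mul_right _ h1)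
    _ = (a * b) ^ (6 * K) := by rw [← mul_assoc, ← pow_add, mul_pow]; congr 2; omega

/-- A majority term is at most `(ab)^{6K}` when `a ≤ b`. [folklore] -/
theorem term_le_of_ge {a b K c : ℕ} (hab : a ≤ b) (hc : 6 * K ≤ c) (hcN : c ≤ 12 * K) :
    a ^ c * b ^ (12 * K - c) ≤ (a * b) ^ (6 * K) := by
  have h1 : a ^ (c - 6 * K) ≤ b ^ (c - 6 * K) := Nat.pow_le_pow_left hab _
  calc a ^ c * b ^ (12 * K - c) = a ^ (6 * K) * a ^ (c - 6 * K) * b ^ (12 * K - c) := by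
        rw [← pow_add]; congr 2; omega
    _ ≤ a ^ (6 * K) * b ^ (c - 6 * K) * b ^ (12 * K - c) :=
        Nat.mul_le_mul_right _ (Nat.mul_le_mul_left _ h1)
    _ = (a * b) ^ (6 * K) := by rw [mul_assoc, ← pow_add, mul_pow]; congr 2; omega

/-- `|c|₀ + |c|₁ = |c|` for a bit string. [folklore] -/
theorem count_false_add_count_true (l : List Bool) : l.count false + l.count true = l.length := by
  have h := List.count_not_add_count l true
  simp only [Bool.not_true] at h
  exact h

/-- **The weights sum to `(a+b)^N`**: `Σ_{c ∈ {0,1}^N} a^{|c|₁} b^{|c|₀} = (a+b)^N` (split on the first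
bit, `GapPClosure.sum_vector_succ`). [folklore] -/
theorem sum_weight_eq (a b : ℕ) : ∀ N : ℕ,
    ∑ c : List.Vector Bool N, a ^ c.toList.count true * b ^ c.toList.count false = (a + b) ^ N
  | 0 => by simp
  | N + 1 => by
    have ht : ∀ c' : List.Vector Bool N,
        a ^ (true ::ᵥ c').toList.count true * b ^ (true ::ᵥ c').toList.count false =
          a * (a ^ c'.toList.count true * b ^ c'.toList.count false) := fun c' => by
      rw [List.Vector.toList_cons, List.count_cons_self, List.count_cons_of_ne (by decide : true ≠ false)]
      ring
    have hf : ∀ c' : List.Vector Bool N,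
        a ^ (false ::ᵥ c').toList.count true * b ^ (false ::ᵥ c').toList.count false =
          b * (a ^ c'.toList.count true * b ^ c'.toList.count false) := fun c' => by
      rw [List.Vector.toList_cons, List.count_cons_of_ne Bool.false_ne_true, List.count_cons_self]
      ring
    rw [sum_vector_succ, Fintype.sum_bool, Finset.sum_congr rfl fun c' _ => ht c',
      Finset.sum_congr rfl fun c' _ => hf c', ← Finset.mul_sum, ← Finset.mul_sum, sum_weight_eq a b N]
    ring

/-- **The minority patterns are light (YES side)**: if `2b ≤ a` then
`2^K · Σ_{c ∈ {0,1}^{12K}, ¬(12K < 2|c|₁)} a^{|c|₁} b^{|c|₀} ≤ (a+b)^{12K}`. [folklore] -/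
theorem sum_minority_le {a b K : ℕ} (h : 2 * b ≤ a) :
    2 ^ K * ∑ c ∈ (univ : Finset (List.Vector Bool (12 * K))).filter
        (fun c => ¬ (12 * K < 2 * c.toList.count true)),
      a ^ c.toList.count true * b ^ c.toList.count false ≤ (a + b) ^ (12 * K) := by
  set F := (univ : Finset (List.Vector Bool (12 * K))).filter (fun c => ¬ (12 * K < 2 * c.toList.count true))
    with hF
  have hterm : ∀ c ∈ F, a ^ c.toList.count true * b ^ c.toList.count false ≤ (a * b) ^ (6 * K) := by
    intro c hc
    have hc' := (mem_filter.1 hc).2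
    have hl := count_false_add_count_true c.toList
    rw [c.toList_length] at hl
    rw [show c.toList.count false = 12 * K - c.toList.count true by omega]
    exact term_le_of_le (by omega) (by omega)
  have hcard : F.card ≤ 2 ^ (12 * K) :=
    (card_filter_le _ _).trans (by rw [card_univ, card_vector, Fintype.card_bool])
  calc 2 ^ K * ∑ c ∈ F, a ^ c.toList.count true * b ^ c.toList.count false
      ≤ 2 ^ K * (F.card * (a * b) ^ (6 * K)) := by
        refine Nat.mul_le_mul_left _ ?_
        have hs := sum_le_card_nsmul F _ _ hterm
        rwa [smul_eq_mul] at hs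
    _ ≤ 2 ^ K * (2 ^ (12 * K) * (a * b) ^ (6 * K)) := Nat.mul_le_mul_left _ (Nat.mul_le_mul_right _ hcard)
    _ = 2 ^ K * 2 ^ (12 * K) * (a * b) ^ (6 * K) := by ring
    _ ≤ (a + b) ^ (12 * K) := key_pow_le (nine_mul_le (Or.inl h))

/-- **The majority patterns are light (NO side)**: if `2a ≤ b` then
`2^K · Σ_{c ∈ {0,1}^{12K}, 12K < 2|c|₁} a^{|c|₁} b^{|c|₀} ≤ (a+b)^{12K}`. [folklore] -/
theorem sum_majority_le {a b K : ℕ} (h : 2 * a ≤ b) :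
    2 ^ K * ∑ c ∈ (univ : Finset (List.Vector Bool (12 * K))).filter
        (fun c => 12 * K < 2 * c.toList.count true),
      a ^ c.toList.count true * b ^ c.toList.count false ≤ (a + b) ^ (12 * K) := by
  set F := (univ : Finset (List.Vector Bool (12 * K))).filter (fun c => 12 * K < 2 * c.toList.count true)
    with hF
  have hterm : ∀ c ∈ F, a ^ c.toList.count true * b ^ c.toList.count false ≤ (a * b) ^ (6 * K) := by
    intro c hc
    have hc' := (mem_filter.1 hc).2
    have hl := count_false_add_count_true c.toList
    rw [c.toList_length] at hl
    rw [show c.toList.count false = 12 * K - c.toList.count true by omega]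
    exact term_le_of_ge (by omega) (by omega) (by omega)
  have hcard : F.card ≤ 2 ^ (12 * K) :=
    (card_filter_le _ _).trans (by rw [card_univ, card_vector, Fintype.card_bool])
  calc 2 ^ K * ∑ c ∈ F, a ^ c.toList.count true * b ^ c.toList.count false
      ≤ 2 ^ K * (F.card * (a * b) ^ (6 * K)) := by
        refine Nat.mul_le_mul_left _ ?_
        have hs := sum_le_card_nsmul F _ _ hterm
        rwa [smul_eq_mul] at hs
    _ ≤ 2 ^ K * (2 ^ (12 * K) * (a * b) ^ (6 * K)) := Nat.mul_le_mul_left _ (Nat.mul_le_mul_right _ hcard)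
    _ = 2 ^ K * 2 ^ (12 * K) * (a * b) ^ (6 * K) := by ring
    _ ≤ (a + b) ^ (12 * K) := key_pow_le (nine_mul_le (Or.inr h))

/-- **Majority vote, YES side**: if `2b ≤ a` then
`2^K · Σ_{c majority} a^{|c|₁} b^{|c|₀} + (a+b)^{12K} ≥ 2^K (a+b)^{12K}`. [folklore] -/
theorem majority_sum_ge {a b K : ℕ} (h : 2 * b ≤ a) :
    2 ^ K * (a + b) ^ (12 * K) ≤
      2 ^ K * (∑ c : List.Vector Bool (12 * K),
        if 12 * K < 2 * c.toList.count true then a ^ c.toList.count true * b ^ c.toList.count false else 0) +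
        (a + b) ^ (12 * K) := by
  have hsplit := Finset.sum_filter_add_sum_filter_not (univ : Finset (List.Vector Bool (12 * K)))
    (fun c => 12 * K < 2 * c.toList.count true) (fun c => a ^ c.toList.count true * b ^ c.toList.count false)
  rw [sum_weight_eq] at hsplit
  have hmin := sum_minority_le (K := K) h
  rw [← Finset.sum_filter]
  calc 2 ^ K * (a + b) ^ (12 * K)
      = 2 ^ K * (∑ c ∈ (univ : Finset (List.Vector Bool (12 * K))).filter
            (fun c => 12 * K < 2 * c.toList.count true), a ^ c.toList.count true * b ^ c.toList.count false) +
        2 ^ K * (∑ c ∈ (univ : Finset (List.Vector Bool (12 * K))).filter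
            (fun c => ¬ (12 * K < 2 * c.toList.count true)), a ^ c.toList.count true * b ^ c.toList.count false) := by
        rw [← mul_add, hsplit]
    _ ≤ _ := Nat.add_le_add_left hmin _

/-- **Majority vote, NO side**: if `2a ≤ b` then `2^K · Σ_{c majority} a^{|c|₁} b^{|c|₀} ≤ (a+b)^{12K}`.
[folklore] -/
theorem majority_sum_le {a b K : ℕ} (h : 2 * a ≤ b) :
    2 ^ K * (∑ c : List.Vector Bool (12 * K),
        if 12 * K < 2 * c.toList.count true then a ^ c.toList.count true * b ^ c.toList.count false else 0) ≤
      (a + b) ^ (12 * K) := by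
  rw [← Finset.sum_filter]
  exact sum_majority_le h

/-- The majority sum is at most the total `(a+b)^N`. [folklore] -/
theorem majority_sum_le_total (a b N : ℕ) :
    (∑ c : List.Vector Bool N,
        if N < 2 * c.toList.count true then a ^ c.toList.count true * b ^ c.toList.count false else 0) ≤
      (a + b) ^ N := by
  rw [← sum_weight_eq a b N]
  exact Finset.sum_le_sum fun c _ => by split_ifs <;> simp

/-- **A product of per-position choices is a monomial in the popcounts**:
`Π_{i<|s|} (if s[i] then a else b) = a^{|s|₁} b^{|s|₀}`. [folklore] -/
theorem prod_ite_getD_eq (a b : ℤ) : ∀ s : List Bool,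
    ∏ i ∈ range s.length, (if s.getD i false = true then a else b) = a ^ s.count true * b ^ s.count false
  | [] => by simp
  | c :: s => by
    rw [List.length_cons, prod_range_succ']
    simp only [List.getD_cons_succ, List.getD_cons_zero]
    rw [prod_ite_getD_eq a b s]
    cases c
    · rw [if_neg Bool.false_ne_true, List.count_cons_of_ne Bool.false_ne_true, List.count_cons_self]
      ring
    · rw [if_pos rfl, List.count_cons_self, List.count_cons_of_ne (by decide : true ≠ false)]
      ring

/-! ### The `P` test "majority of ones" -/

/-- **The majority test** `{⟨v, c⟩ | |c| < 2|c|₁} ∈ P` (compare the binary popcounts of `1^{|c|}`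
and of `c c`, `HashBricks.popCountFn`, `Brick.ltFn`). [folklore] -/
theorem exists_majPat : ∃ M : Language Bool, M ∈ Classes.P ∧
    ∀ v c : List Bool, boolPair v c ∈ M ↔ c.length < 2 * c.count true := by
  obtain ⟨tst, htst⟩ : ∃ f : List Bool → List Bool,
      f = ltFn ∘ fanoutFn (popCountFn ∘ polyFn X ∘ sndF) (popCountFn ∘ (fun w => id w ++ id w) ∘ sndF) := ⟨_, rfl⟩
  have htstFP : tst ∈ FP := htst ▸ comp_mem_FP ltFn_mem_FP
    (fanoutFn_mem_FP (comp_mem_FP popCountFn_mem_FP (comp_mem_FP (polyFn_mem_FP X) sndF_mem_FP))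
      (comp_mem_FP popCountFn_mem_FP (comp_mem_FP (append_mem_FP OracleCompose.id_mem_FP OracleCompose.id_mem_FP)
        sndF_mem_FP)))
  have htst_apply : ∀ w, tst w = [decide ((sndF w).length < 2 * (sndF w).count true)] := fun w => by
    simp only [htst, Function.comp_apply, fanoutFn_apply, polyFn_apply, eval_X, ltFn_boolPair, popCountFn_apply,
      bitsToNat_encodeNat, id, List.count_append, List.count_replicate_self, two_mul]
  refine ⟨{w | (sndF w).length < 2 * (sndF w).count true}, ?_, fun v c => ?_⟩
  · refine mem_P_of_mem_FP htstFP _ fun w => ⟨fun h => ?_, fun h => ?_⟩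
    · rw [htst_apply, decide_eq_true (show (sndF w).length < 2 * (sndF w).count true from h)]
    · rw [htst_apply, decide_eq_false (show ¬ ((sndF w).length < 2 * (sndF w).count true) from h)]
  · show (sndF (boolPair v c)).length < 2 * (sndF (boolPair v c)).count true ↔ _
    rw [sndF_boolPair]

/-! ### The amplifier -/

/-- `0 ≤ g(z) ≤ 2^{p|z|}` for the `GapP` witness of an `AWPP` language. [cite: Fenner2003, Thm. 1.2] -/
theorem bounds_of_AWPP {L : Language Bool} {g : List Bool → ℤ} {p : Polynomial ℕ}
    (hw : ∀ x : List Bool,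
      (x ∈ L → 2 * (2 : ℤ) ^ p.eval x.length ≤ 3 * g x ∧ g x ≤ (2 : ℤ) ^ p.eval x.length) ∧
      (x ∉ L → 0 ≤ g x ∧ 3 * g x ≤ (2 : ℤ) ^ p.eval x.length)) (z : List Bool) :
    0 ≤ g z ∧ g z ≤ (2 : ℤ) ^ p.eval z.length := by
  have hpow : (0 : ℤ) < (2 : ℤ) ^ p.eval z.length := pow_pos two_pos _
  by_cases hz : z ∈ L
  · obtain ⟨h1, h2⟩ := (hw z).1 hz
    exact ⟨by linarith, h2⟩
  · obtain ⟨h1, h2⟩ := (hw z).2 hz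
    exact ⟨h1, by linarith⟩

/-- **Amplification of `AWPP`** (constant error to error `2^{-k}`, with a padding parameter and a
common dyadic denominator). For `L ∈ AWPP` and polynomials `k`, `r` there are `G ∈ GapP` and a
polynomial `e` such that for all `z`, `u` with `|z| ≤ r(|u|)`:
`0 ≤ G⟨z,u⟩ ≤ 2^{e|u|}`, `z ∈ L → (2^{k|u|} - 1)·2^{e|u|} ≤ 2^{k|u|}·G⟨z,u⟩` and
`z ∉ L → 2^{k|u|}·G⟨z,u⟩ ≤ 2^{e|u|}` — the thresholds `1 - 2^{-q}`, `2^{-q}` of Fortnow–Rogers'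
Def. 2.5 (there `f(⟨x, 1^m⟩)/g(1^m)`), obtained from Fenner's constant-error form by a majority vote
over `N = 12(k|u| + 1)` trials written as the `GapP` polynomial
`2^{e|u| - p|z|N} Σ_{|c|₁ > N/2} g(z)^{|c|₁} (2^{p|z|} - g(z))^{|c|₀}`.
[cite: Fenner2003, Thm. 1.2] [cite: FortnowRogers1999JCSS, Def. 2.5 and Thm. 2.2 (arXiv numbering)] -/
theorem exists_amplifier {L : Language Bool} (hL : L ∈ AWPP) (k r : Polynomial ℕ) :
    ∃ G ∈ GapP, ∃ e : Polynomial ℕ, ∀ z u : List Bool, z.length ≤ r.eval u.length →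
      (0 ≤ G (boolPair z u) ∧ G (boolPair z u) ≤ (2 : ℤ) ^ e.eval u.length) ∧
      (z ∈ L → ((2 : ℤ) ^ k.eval u.length - 1) * (2 : ℤ) ^ e.eval u.length ≤
        (2 : ℤ) ^ k.eval u.length * G (boolPair z u)) ∧
      (z ∉ L → (2 : ℤ) ^ k.eval u.length * G (boolPair z u) ≤ (2 : ℤ) ^ e.eval u.length) := by
  obtain ⟨g, hg, p, hw⟩ := mem_AWPP_iff.1 hL
  obtain ⟨B, hBP, hB⟩ := exists_bitSel
  obtain ⟨M, hMP, hM⟩ := exists_majPat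
  -- the polynomials: `Np(n) = 12 (k n + 1)` trials, denominator exponent `e(n) = p(r n) · Np(n)`
  set Np : Polynomial ℕ := 12 * (k + 1) with hNp
  set e : Polynomial ℕ := p.comp r * Np with he
  have eval_Np : ∀ n, Np.eval n = 12 * (k.eval n + 1) := fun n => by simp [hNp]
  have eval_e : ∀ n, e.eval n = p.eval (r.eval n) * (12 * (k.eval n + 1)) := fun n => by
    rw [he, eval_mul, eval_comp, eval_Np]
  -- the factor `c(U)`, `U = ⟨⟨⟨z, u⟩, c⟩, 1ʲ⟩`: `g z` if `c_j = 1`, else `2^{p|z|} - g z`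
  obtain ⟨zOf, hzOf⟩ : ∃ f : List Bool → List Bool, f = fstF ∘ fstF ∘ fstF := ⟨_, rfl⟩
  have hzOfFP : zOf ∈ FP := hzOf ▸ comp_mem_FP fstF_mem_FP (comp_mem_FP fstF_mem_FP fstF_mem_FP)
  have hzOf_apply : ∀ z u c w : List Bool, zOf (boolPair (boolPair (boolPair z u) c) w) = z := by
    intro z u c w; simp [hzOf]
  obtain ⟨cU, hcU⟩ : ∃ f : List Bool → ℤ,
      f = fun U => if U ∈ B then g (zOf U) else (2 : ℤ) ^ p.eval (zOf U).length - g (zOf U) := ⟨_, rfl⟩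
  have hcU_mem : cU ∈ GapP := hcU ▸ piecewise_mem_GapP (comp_mem_GapP hg hzOfFP)
    (sub_mem_GapP (comp_mem_GapP (two_pow_mem_GapP p) hzOfFP) (comp_mem_GapP hg hzOfFP)) hBP
  have hcU_apply : ∀ (z u c : List Bool) (j : ℕ), cU (boolPair (boolPair (boolPair z u) c) (ones j)) =
      if c.getD j false = true then g z else (2 : ℤ) ^ p.eval z.length - g z := by
    intro z u c j
    have hj : (ones j).length = j := List.length_replicate
    rw [hcU]
    show (if boolPair (boolPair (boolPair z u) c) (ones j) ∈ B then g (zOf (boolPair (boolPair (boolPair z u) c) (ones j)))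
      else (2 : ℤ) ^ p.eval (zOf (boolPair (boolPair (boolPair z u) c) (ones j))).length -
        g (zOf (boolPair (boolPair (boolPair z u) c) (ones j)))) = _
    rw [hzOf_apply]
    by_cases hbit : c.getD j false = true
    · rw [if_pos ((hB _ _ _).2 (hj.symm ▸ hbit)), if_pos hbit]
    · rw [if_neg (fun h => hbit (hj ▸ (hB _ _ _).1 h)), if_neg hbit]
  -- the product over the `Np(|u|)` trials, `Y = ⟨⟨z, u⟩, c⟩`
  obtain ⟨tP, htP⟩ : ∃ f : List Bool → List Bool, f = polyFn Np ∘ sndF ∘ fstF := ⟨_, rfl⟩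
  have htPFP : tP ∈ FP := htP ▸ comp_mem_FP (polyFn_mem_FP Np) (comp_mem_FP sndF_mem_FP fstF_mem_FP)
  have htP_apply : ∀ z u c : List Bool, (tP (boolPair (boolPair z u) c)).length = Np.eval u.length := by
    intro z u c; simp [htP]
  obtain ⟨Pr, hPr⟩ : ∃ f : List Bool → ℤ, f = fun Y => ∏ j ∈ range (tP Y).length, cU (boolPair Y (ones j)) :=
    ⟨_, rfl⟩
  have hPr_mem : Pr ∈ GapP := hPr ▸ prod_mem_GapP hcU_mem htPFP
  have hPr_apply : ∀ (z u : List Bool) (c : List.Vector Bool (Np.eval u.length)),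
      Pr (boolPair (boolPair z u) c.toList) =
        g z ^ c.toList.count true * ((2 : ℤ) ^ p.eval z.length - g z) ^ c.toList.count false := by
    intro z u c
    rw [hPr]
    show ∏ j ∈ range (tP (boolPair (boolPair z u) c.toList)).length,
      cU (boolPair (boolPair (boolPair z u) c.toList) (ones j)) = _
    rw [htP_apply, Finset.prod_congr rfl fun j _ => hcU_apply z u c.toList j, ← prod_ite_getD_eq, c.toList_length]
  -- the sum over the majority patterns, `V = ⟨z, u⟩`
  obtain ⟨tS, htS⟩ : ∃ f : List Bool → List Bool, f = polyFn Np ∘ sndF := ⟨_, rfl⟩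
  have htSFP : tS ∈ FP := htS ▸ comp_mem_FP (polyFn_mem_FP Np) sndF_mem_FP
  have htS_apply : ∀ z u : List Bool, (tS (boolPair z u)).length = Np.eval u.length := by
    intro z u; simp [htS]
  obtain ⟨In, hIn⟩ : ∃ f : List Bool → ℤ,
      f = fun V => ∑ c : List.Vector Bool (tS V).length, (if boolPair V c.toList ∈ M then Pr (boolPair V c.toList) else 0) :=
    ⟨_, rfl⟩
  have hIn_mem : In ∈ GapP := hIn ▸ sum_mem_GapP (ite_mem_GapP hPr_mem hMP) htSFP
  -- the scaling exponent `t V = 1^{e|u| - p|z| Np|u|}`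
  obtain ⟨tE, htE⟩ : ∃ f : List Bool → List Bool,
      f = dropFn ∘ fanoutFn (umulFn ∘ fanoutFn (polyFn p ∘ fstF) (polyFn Np ∘ sndF)) (polyFn e ∘ sndF) := ⟨_, rfl⟩
  have htEFP : tE ∈ FP := htE ▸ comp_mem_FP dropFn_mem_FP (fanoutFn_mem_FP
    (comp_mem_FP umulFn_mem_FP (fanoutFn_mem_FP (comp_mem_FP (polyFn_mem_FP p) fstF_mem_FP)
      (comp_mem_FP (polyFn_mem_FP Np) sndF_mem_FP))) (comp_mem_FP (polyFn_mem_FP e) sndF_mem_FP))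
  have htE_apply : ∀ z u : List Bool,
      (tE (boolPair z u)).length = e.eval u.length - p.eval z.length * Np.eval u.length := by
    intro z u
    simp [htE, fanoutFn_apply, umulFn_boolPair, List.drop_replicate]
  -- the amplifier
  refine ⟨fun V => (2 : ℤ) ^ (tE V).length * In V, mul_mem_GapP (two_pow_length_mem_GapP htEFP) hIn_mem, e,
    fun z u hz => ?_⟩
  -- notation and the integer bookkeeping at `⟨z, u⟩`
  set n := u.length with hn
  set K := k.eval n + 1 with hK
  set P := p.eval z.length with hP
  obtain ⟨ha0, haD⟩ := bounds_of_AWPP hw z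
  set a : ℕ := (g z).toNat with ha
  set b : ℕ := ((2 : ℤ) ^ P - g z).toNat with hb
  have haZ : (a : ℤ) = g z := Int.toNat_of_nonneg ha0
  have hbZ : (b : ℤ) = (2 : ℤ) ^ P - g z := Int.toNat_of_nonneg (by rw [hP]; linarith)
  have habD : a + b = 2 ^ P := by
    have h : ((a + b : ℕ) : ℤ) = ((2 ^ P : ℕ) : ℤ) := by push_cast; rw [haZ, hbZ]; ring
    exact_mod_cast h
  have hNn : Np.eval n = 12 * K := by rw [eval_Np, hK]
  have hPle : P * (12 * K) ≤ e.eval n := by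
    rw [eval_e, ← hK, hP]
    exact Nat.mul_le_mul_right _ (TM2Iter.eval_mono p hz)
  -- the value of the amplifier
  set Mj : ℕ := ∑ c : List.Vector Bool (12 * K),
    (if 12 * K < 2 * c.toList.count true then a ^ c.toList.count true * b ^ c.toList.count false else 0) with hMj
  have hIn_val : In (boolPair z u) = (Mj : ℤ) := by
    rw [hIn]
    show ∑ c : List.Vector Bool (tS (boolPair z u)).length,
      (if boolPair (boolPair z u) c.toList ∈ M then Pr (boolPair (boolPair z u) c.toList) else 0) = _
    have hlen : (tS (boolPair z u)).length = 12 * K := by rw [htS_apply, ← hn, hNn]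
    rw [hMj, Nat.cast_sum]
    -- reindex along `hlen`
    have key : ∀ (m : ℕ) (hm : (tS (boolPair z u)).length = m),
        ∑ c : List.Vector Bool (tS (boolPair z u)).length,
          (if boolPair (boolPair z u) c.toList ∈ M then Pr (boolPair (boolPair z u) c.toList) else 0) =
        ∑ c : List.Vector Bool m,
          (if m < 2 * c.toList.count true then
            ((a ^ c.toList.count true * b ^ c.toList.count false : ℕ) : ℤ) else 0) := by
      intro m hm
      subst hm
      refine Finset.sum_congr rfl fun c _ => ?_
      have hmem : boolPair (boolPair z u) c.toList ∈ M ↔ (tS (boolPair z u)).length < 2 * c.toList.count true := by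
        rw [hM, c.toList_length]
      by_cases hmaj : (tS (boolPair z u)).length < 2 * c.toList.count true
      · rw [if_pos (hmem.2 hmaj), if_pos hmaj]
        have hc : Pr (boolPair (boolPair z u) c.toList) =
            g z ^ c.toList.count true * ((2 : ℤ) ^ p.eval z.length - g z) ^ c.toList.count false := by
          have h' := hPr_apply z u ⟨c.toList, by rw [c.toList_length, htS_apply]⟩
          exact h'
        rw [hc, ← hP, ← hbZ, ← haZ]
        push_cast
        ring
      · rw [if_neg (fun h => hmaj (hmem.1 h)), if_neg hmaj]
    rw [key (12 * K) hlen]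
    refine Finset.sum_congr rfl fun c _ => ?_
    push_cast
    split_ifs <;> rfl
  have hG_val : (2 : ℤ) ^ (tE (boolPair z u)).length * In (boolPair z u) =
      (2 : ℤ) ^ (e.eval n - P * (12 * K)) * (Mj : ℤ) := by
    rw [hIn_val, htE_apply, ← hn, hNn]
  -- the estimates
  have hMj_le : Mj ≤ 2 ^ (P * (12 * K)) := by
    rw [pow_mul, ← habD]; exact majority_sum_le_total a b (12 * K)
  have htwo : (2 : ℤ) ^ (e.eval n - P * (12 * K)) * (2 : ℤ) ^ (P * (12 * K)) = (2 : ℤ) ^ e.eval n := by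
    rw [← pow_add, Nat.sub_add_cancel hPle]
  have hpos : (0 : ℤ) ≤ (2 : ℤ) ^ (e.eval n - P * (12 * K)) := pow_nonneg (by norm_num) _
  show (0 ≤ (2 : ℤ) ^ (tE (boolPair z u)).length * In (boolPair z u) ∧
      (2 : ℤ) ^ (tE (boolPair z u)).length * In (boolPair z u) ≤ (2 : ℤ) ^ e.eval n) ∧
    (z ∈ L → ((2 : ℤ) ^ k.eval n - 1) * (2 : ℤ) ^ e.eval n ≤
      (2 : ℤ) ^ k.eval n * ((2 : ℤ) ^ (tE (boolPair z u)).length * In (boolPair z u))) ∧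
    (z ∉ L → (2 : ℤ) ^ k.eval n * ((2 : ℤ) ^ (tE (boolPair z u)).length * In (boolPair z u)) ≤ (2 : ℤ) ^ e.eval n)
  rw [hG_val]
  refine ⟨⟨by positivity, ?_⟩, fun hzL => ?_, fun hzL => ?_⟩
  · -- `G ≤ 2^e`
    have h : (Mj : ℤ) ≤ (2 : ℤ) ^ (P * (12 * K)) := by exact_mod_cast hMj_le
    calc (2 : ℤ) ^ (e.eval n - P * (12 * K)) * (Mj : ℤ)
        ≤ (2 : ℤ) ^ (e.eval n - P * (12 * K)) * (2 : ℤ) ^ (P * (12 * K)) := mul_le_mul_of_nonneg_left h hpos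
      _ = (2 : ℤ) ^ e.eval n := htwo
  · -- YES: `2b ≤ a`, the majority patterns carry all but `2^{-K}` of the mass
    have h2b : 2 * b ≤ a := by
      have h1 := ((hw z).1 hzL).1
      have h' : 2 * (b : ℤ) ≤ (a : ℤ) := by rw [haZ, hbZ, hP]; linarith
      exact_mod_cast h'
    have hmaj := majority_sum_ge (K := K) h2b
    rw [habD, ← pow_mul, ← hMj] at hmaj
    have hmajZ : (2 : ℤ) ^ K * (2 : ℤ) ^ (P * (12 * K)) ≤ (2 : ℤ) ^ K * (Mj : ℤ) + (2 : ℤ) ^ (P * (12 * K)) := by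
      exact_mod_cast hmaj
    -- multiply by `2^{e - P N}`
    have h1 : (2 : ℤ) ^ K * (2 : ℤ) ^ e.eval n ≤
        (2 : ℤ) ^ K * ((2 : ℤ) ^ (e.eval n - P * (12 * K)) * (Mj : ℤ)) + (2 : ℤ) ^ e.eval n := by
      have h := mul_le_mul_of_nonneg_left hmajZ hpos
      calc (2 : ℤ) ^ K * (2 : ℤ) ^ e.eval n
          = (2 : ℤ) ^ (e.eval n - P * (12 * K)) * ((2 : ℤ) ^ K * (2 : ℤ) ^ (P * (12 * K))) := by
            rw [← htwo]; ring
        _ ≤ (2 : ℤ) ^ (e.eval n - P * (12 * K)) * ((2 : ℤ) ^ K * (Mj : ℤ) + (2 : ℤ) ^ (P * (12 * K))) := h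
        _ = (2 : ℤ) ^ K * ((2 : ℤ) ^ (e.eval n - P * (12 * K)) * (Mj : ℤ)) + (2 : ℤ) ^ e.eval n := by
            rw [← htwo]; ring
    have hK2 : (2 : ℤ) ^ K = 2 * (2 : ℤ) ^ k.eval n := by rw [hK, pow_succ, mul_comm]
    rw [hK2] at h1
    have hepos : (0 : ℤ) ≤ (2 : ℤ) ^ e.eval n := pow_nonneg (by norm_num) _
    nlinarith [h1, hepos]
  · -- NO: `2a ≤ b`, the majority patterns carry at most `2^{-K}` of the mass
    have h2a : 2 * a ≤ b := by
      have h1 := ((hw z).2 hzL).2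
      have h' : 2 * (a : ℤ) ≤ (b : ℤ) := by rw [haZ, hbZ, hP]; linarith
      exact_mod_cast h'
    have hmaj := majority_sum_le (K := K) h2a
    rw [habD, ← pow_mul, ← hMj] at hmaj
    have hmajZ : (2 : ℤ) ^ K * (Mj : ℤ) ≤ (2 : ℤ) ^ (P * (12 * K)) := by exact_mod_cast hmaj
    have h1 : (2 : ℤ) ^ K * ((2 : ℤ) ^ (e.eval n - P * (12 * K)) * (Mj : ℤ)) ≤ (2 : ℤ) ^ e.eval n := by
      have h := mul_le_mul_of_nonneg_left hmajZ hpos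
      calc (2 : ℤ) ^ K * ((2 : ℤ) ^ (e.eval n - P * (12 * K)) * (Mj : ℤ))
          = (2 : ℤ) ^ (e.eval n - P * (12 * K)) * ((2 : ℤ) ^ K * (Mj : ℤ)) := by ring
        _ ≤ (2 : ℤ) ^ (e.eval n - P * (12 * K)) * (2 : ℤ) ^ (P * (12 * K)) := h
        _ = (2 : ℤ) ^ e.eval n := htwo
    have hMjpos : (0 : ℤ) ≤ (2 : ℤ) ^ (e.eval n - P * (12 * K)) * (Mj : ℤ) := by positivity
    have hkK : (2 : ℤ) ^ k.eval n ≤ (2 : ℤ) ^ K := pow_le_pow_right₀ (by norm_num) (by rw [hK]; omega)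
    calc (2 : ℤ) ^ k.eval n * ((2 : ℤ) ^ (e.eval n - P * (12 * K)) * (Mj : ℤ))
        ≤ (2 : ℤ) ^ K * ((2 : ℤ) ^ (e.eval n - P * (12 * K)) * (Mj : ℤ)) := mul_le_mul_of_nonneg_right hkK hMjpos
      _ ≤ (2 : ℤ) ^ e.eval n := h1

end AWPPAmp

end Literature.Computability.QuantumComplexity

end
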